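import Mathlib
import HarnessLib
import Summits.Ventures.LatticeQCDFlow.Exactness.PseudoMarginalFlowSampler
import Summits.Ventures.LatticeQCDFlow.Exactness.IMHMultiProposalMinorisation

/-!
# Averaging `N` independent weight estimates (`N_pf` pseudofermion draws): the pseudo-marginal flow sampler stays exact for every `N`, and its
# `χ²` obeys the EXACT law `1 + χ̂²_N = 1 + χ² + V/N`, `V = E_q[Var_κ ŵ]` — so `ESS(N) = ESS(∞)/(1 + C/N)` with `C = V·ESS(∞)` identified,
# on a general state space

HONEST FRAMING: exact (Metropolis-corrected) sampling algorithms for lattice gauge theory;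
figures of merit are autocorrelation/cost numbers at stated couplings and volumes; no
continuum-physics claim.

Venture `LatticeQCDFlow` (cell pub-lqcd), topic `Exactness`; FANOUT row 30 (lean-1, GEN-42).  NEW WORK of the cell on GENERAL measurable spaces
over Mathlib (`ProbabilityTheory.variance_sum_pi`, `variance_const_mul`, `variance_eq_sub`, product measures) and this generation's
`PseudoMarginalFlowSampler`.  The tree's `Literature/Probability/ImportanceSampling/PseudofermionESS.lean` formalises the printed FINITE-space
derivation of the `ESS(N_pf)` law of Abbott et al. 2022 (App. A) for importance sampling; this file is its continuous-noise counterpart, stated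
for the EXACT (accept/reject) sampler's inputs, with the kernel-level exactness for every `N`.  Nothing is cited as a fact.

## Setting
Flow law `q` on `Ω`; noise law `κ : Kernel Ω U`; one-draw estimate `ŵ : Ω × U → ℝ`, positive, square integrable and unbiased for `w` under `κ_x`;
`N ≥ 1` independent noise draws: `κ_N : Kernel Ω (Fin N → U)` with `κ_N(x) = κ_x^{⊗N}` (hypothesis `hκN`, def-free) and the AVERAGED estimate
`ŵ_N(x, u) = (Σ_i ŵ(x, u_i))/N`.

## Results (no `sorry`, no new definitions)
* §1 ONE CONFIGURATION (`m` a probability law, `g ∈ L²(m)`, `u ∼ m^{⊗N}`): `average_integral_eq` (`E[(Σ_i g(u_i))/N] = ∫ g dm`),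
  **`average_variance_eq`** (`Var[(Σ_i g(u_i))/N] = Var[g]/N`, Mathlib's `variance_sum_pi`), **`average_sq_integral_eq`**
  (`E[((Σ_i g(u_i))/N)²] = (∫ g dm)² + Var[g]/N`).
* §2 THE `N`-DRAW PSEUDO-MARGINAL FLOW SAMPLER: `measurable_avgEstimate`, `avgEstimate_pos`, **`avgEstimate_unbiased`** (`ŵ_N` is unbiased for
  `w`), **`avgEstimate_target_map_fst`** ∕ **`avgEstimate_invariant`** — for EVERY `N` the run `indepMH (q ⊗ₘ κ_N) ŵ_N` is exact: the extended
  target's configuration marginal is `π = w·q` and it is invariant (`PseudoMarginalFlowSampler`); **`avgEstimate_sq_integral_eq`** —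
  `E_{κ_N}[ŵ_N(x, ·)²] = w(x)² + Var_κ ŵ(x, ·)/N` per configuration; **`avgEstimate_lintegral_sq_eq`** — THE LAW:
  `E_{q ⊗ κ_N}[ŵ_N²] = E_q[w²] + (1/N)·E_q[v]` for any measurable version `v` of `x ↦ Var_κ ŵ(x, ·)` — i.e. `1 + χ̂²_N = (1 + χ²) + V/N`.
* §3 THE PRINTED SHAPE: `essLaw_eq` (`1/(S + V/N) = (1/S)/(1 + (V/S)/N)`: with `S = 1 + χ² = 1/ESS(∞)` this is `ESS(N) = ESS(∞)/(1 + C/N)`,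
  `C = V·ESS(∞)`), `essLaw_le` (`ESS(N) ≤ ESS(∞)`), `essLaw_mono` (non-decreasing in `N`), `essLaw_tendsto` (`→ ESS(∞)`),
  `essLaw_ge_of_le` (`N ≥ (V/S)/η ⇒ ESS(N) ≥ ESS(∞)/(1 + η)`: the number of draws that buys a `(1 + η)`-fraction of the noiseless ESS).
Reading (gauge files with pseudofermions): the accept/reject sampler with `N_pf` averaged stochastic determinant estimates is exact for every
`N_pf`; its weight-`χ²` — the input of the tree's certified error bars — decreases to the exact-determinant value exactly like `V/N_pf`, and the
printed `ESS(N_pf) = ESS(∞)/(1 + C/N_pf)` is an identity with `C = E_q[Var ŵ]·ESS(∞)`.  NOT CLAIMED: the `N`-dependence of `c₁` (only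
`ĉ₁ ≤ c₁`, `PseudoMarginalFlowSampler`); any cost optimum (see `Scaling/PseudofermionBudget`).
-/

noncomputable section

namespace Summit.Ventures.LatticeQCDFlow.Exactness

open MeasureTheory ProbabilityTheory Finset
open scoped ENNReal

/-! ## §1 Averaging `N` independent draws at one configuration -/

section OneConfiguration

variable {U : Type*} [MeasurableSpace U] {m : Measure U} [IsProbabilityMeasure m] {g : U → ℝ} {N : ℕ}

/-- `E_{m^{⊗N}}[(Σ_i g(u_i))/N] = ∫ g dm`. [ours] -/
theorem average_integral_eq [NeZero N] (hgm : Measurable g) (hg : Integrable g m) :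
    ∫ u, (∑ i, g (u i)) / N ∂(Measure.pi fun _ : Fin N => m) = ∫ v, g v ∂m := by
  have hi : ∀ i : Fin N, Integrable (fun u : Fin N → U => g (u i)) (Measure.pi fun _ : Fin N => m) := fun i =>
    ((measurePreserving_eval (fun _ : Fin N => m) i).integrable_comp hg.aestronglyMeasurable).2 hg
  rw [integral_div, integral_finsetSum _ fun i _ => hi i]
  simp_rw [integral_coord_weight_eq (q := m) hgm]
  rw [sum_const, card_univ, Fintype.card_fin, nsmul_eq_mul, mul_div_assoc, mul_div_cancel₀ _ (Nat.cast_ne_zero.2 (NeZero.ne N))]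

/-- **`Var_{m^{⊗N}}[(Σ_i g(u_i))/N] = Var_m[g]/N`** for `g ∈ L²(m)` — independence of the coordinates under the product law. [ours — Mathlib's
`variance_sum_pi`] -/
theorem average_variance_eq [NeZero N] (hg : MemLp g 2 m) :
    variance (fun u : Fin N → U => (∑ i, g (u i)) / N) (Measure.pi fun _ : Fin N => m) = variance g m / N := by
  have h1 : (fun u : Fin N → U => (∑ i, g (u i)) / N) = fun u => (N : ℝ)⁻¹ * (∑ i, fun ω : Fin N → U => g (ω i)) u := by
    funext u; rw [Finset.sum_apply, div_eq_inv_mul]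
  rw [h1, variance_const_mul, variance_sum_pi (X := fun _ : Fin N => g) (fun _ => hg)]
  simp only [sum_const, card_univ, Fintype.card_fin, nsmul_eq_mul]
  have hN : (N : ℝ) ≠ 0 := Nat.cast_ne_zero.2 (NeZero.ne N)
  field_simp

/-- The averaged draw is square integrable. [ours, bookkeeping] -/
theorem memLp_average (hg : MemLp g 2 m) :
    MemLp (fun u : Fin N → U => (∑ i, g (u i)) / N) 2 (Measure.pi fun _ : Fin N => m) := by
  have h : MemLp (fun u : Fin N → U => ∑ i, g (u i)) 2 (Measure.pi fun _ : Fin N => m) :=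
    memLp_finsetSum _ fun i _ => hg.comp_measurePreserving (measurePreserving_eval (fun _ : Fin N => m) i)
  have heq : (fun u : Fin N → U => (∑ i, g (u i)) / N) = fun u => (N : ℝ)⁻¹ * ∑ i, g (u i) := by
    funext u; rw [div_eq_inv_mul]
  rw [heq]
  exact h.const_mul _

/-- **`E_{m^{⊗N}}[((Σ_i g(u_i))/N)²] = (∫ g dm)² + Var_m[g]/N`**. [ours] -/
theorem average_sq_integral_eq [NeZero N] (hgm : Measurable g) (hg : MemLp g 2 m) :
    ∫ u, ((∑ i, g (u i)) / N) ^ 2 ∂(Measure.pi fun _ : Fin N => m) = (∫ v, g v ∂m) ^ 2 + variance g m / N := by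
  have hv := variance_eq_sub (memLp_average (N := N) hg)
  rw [average_variance_eq hg, average_integral_eq hgm (hg.integrable one_le_two)] at hv
  simp only [Pi.pow_apply] at hv
  linarith

end OneConfiguration

/-! ## §2 The `N`-draw pseudo-marginal flow sampler -/

section Sampler

variable {Ω U : Type*} [MeasurableSpace Ω] [MeasurableSpace U]
  {q : Measure Ω} [IsProbabilityMeasure q] {κ : Kernel Ω U} [IsMarkovKernel κ]
  {w : Ω → ℝ} {west : Ω × U → ℝ} {N : ℕ}

/-- The averaged estimate `ŵ_N(x, u) = (Σ_i ŵ(x, u_i))/N` is measurable. [ours, bookkeeping] -/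
theorem measurable_avgEstimate (hW : Measurable west) :
    Measurable fun z : Ω × (Fin N → U) => (∑ i, west (z.1, z.2 i)) / N :=
  (Finset.measurable_sum _ fun i _ => hW.comp (measurable_fst.prodMk ((measurable_pi_apply i).comp measurable_snd))).div_const _

omit [MeasurableSpace Ω] [MeasurableSpace U] in
/-- … and positive (`N ≥ 1`). [ours, bookkeeping] -/
theorem avgEstimate_pos [NeZero N] (hW0 : ∀ z, 0 < west z) (z : Ω × (Fin N → U)) : 0 < (∑ i, west (z.1, z.2 i)) / N := by
  have hN : 0 < (N : ℝ) := Nat.cast_pos.2 (Nat.pos_of_ne_zero (NeZero.ne N))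
  haveI : Nonempty (Fin N) := ⟨⟨0, Nat.pos_of_ne_zero (NeZero.ne N)⟩⟩
  exact div_pos (sum_pos (fun i _ => hW0 _) univ_nonempty) hN

/-- The `N`-draw noise kernel is Markov. [ours, bookkeeping] -/
theorem isMarkovKernel_of_pi (κN : Kernel Ω (Fin N → U)) (hκN : ∀ x, κN x = Measure.pi fun _ : Fin N => κ x) : IsMarkovKernel κN :=
  ⟨fun x => by rw [hκN x]; infer_instance⟩

/-- **`ŵ_N` IS UNBIASED FOR `w`** (in the `∫⁻` form used by `PseudoMarginalFlowSampler`). [ours] -/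
theorem avgEstimate_unbiased [NeZero N] (hW : Measurable west) (hW0 : ∀ z, 0 < west z) (hmem : ∀ x, MemLp (fun u => west (x, u)) 2 (κ x))
    (hunb : ∀ x, ∫ u, west (x, u) ∂(κ x) = w x) (κN : Kernel Ω (Fin N → U)) (hκN : ∀ x, κN x = Measure.pi fun _ : Fin N => κ x) (x : Ω) :
    ∫⁻ u, ENNReal.ofReal ((∑ i, west (x, u i)) / N) ∂(κN x) = ENNReal.ofReal (w x) := by
  rw [hκN x]
  have hint : Integrable (fun u : Fin N → U => (∑ i, west (x, u i)) / N) (Measure.pi fun _ : Fin N => κ x) :=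
    (memLp_average (hmem x)).integrable one_le_two
  have hgm : Measurable fun u => west (x, u) := hW.comp measurable_prodMk_left
  rw [← ofReal_integral_eq_lintegral_ofReal hint (ae_of_all _ fun u => (avgEstimate_pos hW0 (x, u)).le),
    average_integral_eq (g := fun u => west (x, u)) hgm ((hmem x).integrable one_le_two), hunb]

/-- **THE `N`-DRAW SAMPLER IS EXACT FOR EVERY `N`**: the extended target `ŵ_N·(q ⊗ₘ κ_N)` has configuration marginal `π = w·q` …
[ours — `pseudoMarginal_target_map_fst`] -/
theorem avgEstimate_target_map_fst [NeZero N] (hW : Measurable west) (hW0 : ∀ z, 0 < west z)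
    (hmem : ∀ x, MemLp (fun u => west (x, u)) 2 (κ x)) (hunb : ∀ x, ∫ u, west (x, u) ∂(κ x) = w x)
    (κN : Kernel Ω (Fin N → U)) [IsMarkovKernel κN] (hκN : ∀ x, κN x = Measure.pi fun _ : Fin N => κ x) :
    ((q ⊗ₘ κN).withDensity fun z => ENNReal.ofReal ((∑ i, west (z.1, z.2 i)) / N)).map Prod.fst = q.withDensity fun x => ENNReal.ofReal (w x) :=
  pseudoMarginal_target_map_fst (κ := κN) (west := fun z => (∑ i, west (z.1, z.2 i)) / N) (measurable_avgEstimate hW)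
    (avgEstimate_unbiased hW hW0 hmem hunb κN hκN)

/-- … and is invariant under the run `indepMH (q ⊗ₘ κ_N) ŵ_N`. [ours — `pseudoMarginal_invariant`] -/
theorem avgEstimate_invariant [NeZero N] (hW : Measurable west) (hW0 : ∀ z, 0 < west z)
    (κN : Kernel Ω (Fin N → U)) [IsMarkovKernel κN] :
    Kernel.Invariant (indepMH (q ⊗ₘ κN) fun z => (∑ i, west (z.1, z.2 i)) / N)
      ((q ⊗ₘ κN).withDensity fun z => ENNReal.ofReal ((∑ i, west (z.1, z.2 i)) / N)) :=
  pseudoMarginal_invariant (measurable_avgEstimate hW) (avgEstimate_pos hW0)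

/-- **THE SECOND MOMENT PER CONFIGURATION: `E_{κ_N}[ŵ_N(x, ·)²] = w(x)² + Var_κ ŵ(x, ·)/N`.** [ours] -/
theorem avgEstimate_sq_integral_eq [NeZero N] (hW : Measurable west) (hmem : ∀ x, MemLp (fun u => west (x, u)) 2 (κ x))
    (hunb : ∀ x, ∫ u, west (x, u) ∂(κ x) = w x) (κN : Kernel Ω (Fin N → U)) (hκN : ∀ x, κN x = Measure.pi fun _ : Fin N => κ x) (x : Ω) :
    ∫ u, ((∑ i, west (x, u i)) / N) ^ 2 ∂(κN x) = w x ^ 2 + variance (fun u => west (x, u)) (κ x) / N := by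
  have hgm : Measurable fun u => west (x, u) := hW.comp measurable_prodMk_left
  rw [hκN x, average_sq_integral_eq (g := fun u => west (x, u)) hgm (hmem x), hunb]

/-- **THE LAW `1 + χ̂²_N = (1 + χ²) + V/N`**: `E_{q ⊗ κ_N}[ŵ_N²] = E_q[w²] + (1/N)·E_q[v]` for any measurable version `v` of the conditional variance
`x ↦ Var_κ ŵ(x, ·)` (in `ℝ≥0∞`, no global integrability needed). [ours] -/
theorem avgEstimate_lintegral_sq_eq [NeZero N] (hW : Measurable west) (hmem : ∀ x, MemLp (fun u => west (x, u)) 2 (κ x))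
    (hunb : ∀ x, ∫ u, west (x, u) ∂(κ x) = w x) (κN : Kernel Ω (Fin N → U)) [IsMarkovKernel κN]
    (hκN : ∀ x, κN x = Measure.pi fun _ : Fin N => κ x)
    {v : Ω → ℝ} (hvm : Measurable v) (hv : ∀ x, variance (fun u => west (x, u)) (κ x) = v x) (hwm : Measurable w) :
    ∫⁻ z, ENNReal.ofReal (((∑ i, west (z.1, z.2 i)) / N) ^ 2) ∂(q ⊗ₘ κN) =
      ∫⁻ x, ENNReal.ofReal (w x ^ 2) ∂q + ENNReal.ofReal (1 / N) * ∫⁻ x, ENNReal.ofReal (v x) ∂q := by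
  rw [Measure.lintegral_compProd ((measurable_avgEstimate hW).pow_const 2).ennreal_ofReal]
  have hpt : ∀ x, ∫⁻ u, ENNReal.ofReal (((∑ i, west (x, u i)) / N) ^ 2) ∂(κN x) = ENNReal.ofReal (w x ^ 2) + ENNReal.ofReal (1 / N) * ENNReal.ofReal (v x) := by
    intro x
    have hint : Integrable (fun u : Fin N → U => ((∑ i, west (x, u i)) / N) ^ 2) (κN x) := by
      rw [hκN x]; exact (memLp_average (hmem x)).integrable_sq
    rw [← ofReal_integral_eq_lintegral_ofReal hint (ae_of_all _ fun u => sq_nonneg _), avgEstimate_sq_integral_eq hW hmem hunb κN hκN x, hv x,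
      ← ENNReal.ofReal_mul (by positivity), ← ENNReal.ofReal_add (sq_nonneg _) (mul_nonneg (by positivity) ?_)]
    · congr 1; ring
    · rw [← hv x]; exact variance_nonneg _ _
  simp_rw [hpt]
  rw [lintegral_add_left (hwm.pow_const 2).ennreal_ofReal, lintegral_const_mul _ hvm.ennreal_ofReal]

end Sampler

/-! ## §3 The printed shape `ESS(N) = ESS(∞)/(1 + C/N)` -/

section Law

/-- **`1/(S + V/N) = (1/S)/(1 + (V/S)/N)`**: with `S = 1 + χ² = 1/ESS(∞)` and `V = E_q[Var_κ ŵ]`, the `N`-draw effective sample size is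
`ESS(N) = ESS(∞)/(1 + C/N)` with `C = V·ESS(∞) = V/S`. [ours] -/
theorem essLaw_eq {S V N : ℝ} (hS : 0 < S) (hN : 0 < N) : 1 / (S + V / N) = (1 / S) / (1 + (V / S) / N) := by
  field_simp

/-- `ESS(N) ≤ ESS(∞)`: noise only lowers the effective sample size. [ours] -/
theorem essLaw_le {S V N : ℝ} (hS : 0 < S) (hV : 0 ≤ V) (hN : 0 < N) : 1 / (S + V / N) ≤ 1 / S :=
  one_div_le_one_div_of_le hS (le_add_of_nonneg_right (div_nonneg hV hN.le))

/-- `ESS(N)` is non-decreasing in `N`. [ours] -/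
theorem essLaw_mono {S V N N' : ℝ} (hS : 0 < S) (hV : 0 ≤ V) (hN : 0 < N) (hNN' : N ≤ N') : 1 / (S + V / N) ≤ 1 / (S + V / N') := by
  have h := div_le_div_of_nonneg_left hV hN hNN'
  exact one_div_le_one_div_of_le (add_pos_of_pos_of_nonneg hS (div_nonneg hV (hN.le.trans hNN'))) (by linarith)

/-- `ESS(N) → ESS(∞)` as `N → ∞`. [ours] -/
theorem essLaw_tendsto {S V : ℝ} (hS : 0 < S) :
    Filter.Tendsto (fun N : ℕ => 1 / (S + V / N)) Filter.atTop (nhds (1 / S)) := by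
  have h : Filter.Tendsto (fun N : ℕ => S + V / N) Filter.atTop (nhds (S + 0)) :=
    tendsto_const_nhds.add (tendsto_const_div_atTop_nhds_zero_nat V)
  rw [add_zero] at h
  exact (tendsto_const_nhds.div h hS.ne')

/-- **How many draws**: `N ≥ (V/S)/η` gives `ESS(N) ≥ ESS(∞)/(1 + η)`. [ours] -/
theorem essLaw_ge_of_le {S V N η : ℝ} (hS : 0 < S) (hV : 0 ≤ V) (hN : 0 < N) (hη : 0 < η) (hNη : V / S / η ≤ N) :
    (1 / S) / (1 + η) ≤ 1 / (S + V / N) := by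
  rw [essLaw_eq hS hN]
  have hCS : 0 ≤ V / S := div_nonneg hV hS.le
  have h1 : V / S / N ≤ η := by
    rw [div_le_iff₀ hN]
    calc V / S = V / S / η * η := by field_simp
      _ ≤ N * η := mul_le_mul_of_nonneg_right hNη hη.le
      _ = η * N := mul_comm _ _
  exact div_le_div_of_nonneg_left (by positivity) (by positivity) (by linarith)

end Law

end Summit.Ventures.LatticeQCDFlow.Exactness
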